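import Mathlib.Topology.TietzeExtension
import Mathlib.Analysis.Convex.Topology
import Literature.Topology.PlaneTopology.JordanSweepParity
import Literature.Topology.PlaneTopology.Schoenflies
import HarnessLib

/-!
# Retractions onto arcs; pushing a loop off the closed unit disc without changing winding numbers

Topic: Topology / PlaneTopology.  Two folklore tools of plane topology used to prove that a Jordan
loop surrounding a corner of a Jordan domain traverses the domain between the two boundary arcs at
that corner (`JordanLoopCornerTraverse.lean`; the continuum input of the approximate equicontinuity
of separating probabilities, Bollobás–Riordan, *Percolation* (2006), Ch. 7, proof of Claim 22,
p. 198):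

* `exists_retraction_onto_arc` — an arc `f([α, β])` (`f` continuous, injective on `[α, β]`) is a
  retract of the plane: Tietze's extension theorem applied to the inverse parametrisation
  (continuous by compactness, `Schoenflies.continuousOn_invFunOn`).
* `wind_sub_eq_of_push` — **the push lemma.**  Let `Γ` be a loop on `[0, 1]` starting outside the
  closed unit disc `K`, and suppose the times at which `Γ` is in `K` are covered by two disjoint
  closed sets `Z₁, Z₂ ⊆ [0, 1]` such that at a time of `Z_ℓ` where `Γ` is on the unit circle it is in
  a compact subset `R_ℓ` of the circle, `R_ℓ` a retract of the plane (retraction `π_ℓ`).  Then for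
  any two points `c, a` of the circle off `R₁ ∪ R₂ ∪ Γ`, the winding numbers of `Γ` about `c` and
  about `a` agree.  Proof: replace `Γ` on `Z_ℓ` by `π_ℓ ∘ Γ`; the new loop is continuous (the
  boundary times of `Z_ℓ` are circle times, fixed by `π_ℓ`), straight-line homotopic to `Γ` in
  `ℂ ∖ {c, a}` (convexity of the disc: the moving point is in the open disc or fixed), hence has the
  same winding numbers about `c` and `a` (`wind_eq_of_homotopy`), and it misses the connected set
  `𝔻 ∪ B(c, d) ∪ B(a, d)` containing `c` and `a`, so these two winding numbers coincide
  (`wind_sub_eq_of_mem_connectedComponentIn`).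

No Jordan curve theorem is used here; everything is stated for continuous loops.

## References
* B. Bollobás, O. Riordan, *Percolation*, CUP (2006), Ch. 7 p. 198. [BollobasRiordan2006]
* M. H. A. Newman, *Elements of the topology of plane sets of points* (1939), Ch. V. [Newman1939]
-/

noncomputable section

namespace Literature.Topology.PlaneTopology

open Set Metric Filter Function _root_.Topology

/-! ### Arcs are retracts of the plane -/

/-- **An arc is a retract of the plane.**  If `f : ℝ → ℂ` is continuous and injective on
`[α, β]` (`α ≤ β`), there is a continuous `π : ℂ → ℂ` with values in the arc `f '' [α, β]` fixing
every point of the arc (Tietze extension of the inverse parametrisation). [folklore] -/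
theorem exists_retraction_onto_arc {f : ℝ → ℂ} (hf : Continuous f) {α β : ℝ} (hαβ : α ≤ β)
    (hinj : InjOn f (Icc α β)) :
    ∃ π : ℂ → ℂ, Continuous π ∧ (∀ p, π p ∈ f '' Icc α β) ∧ ∀ p ∈ f '' Icc α β, π p = p := by
  set K : Set ℂ := f '' Icc α β with hK
  have hKc : IsCompact K := isCompact_Icc.image hf
  set g : ℂ → ℝ := invFunOn f (Icc α β) with hg
  have hgc : ContinuousOn g K :=
    Schoenflies.continuousOn_invFunOn isCompact_Icc hf.continuousOn hinj
  have hgmem : ∀ p ∈ K, g p ∈ Icc α β := fun p hp => invFunOn_mem hp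
  have hfg : ∀ p ∈ K, f (g p) = p := fun p hp => invFunOn_eq hp
  set G₀ : C(K, ℝ) := ⟨fun p => g p, hgc.restrict⟩ with hG₀
  obtain ⟨G, hGmem, hGres⟩ := G₀.exists_restrict_eq_forall_mem_of_closed (t := Icc α β)
    (fun p => hgmem p p.2) (nonempty_Icc.2 hαβ) hKc.isClosed
  have hGg : ∀ p ∈ K, G p = g p := fun p hp => by
    have := congrArg (fun h : C(K, ℝ) => h ⟨p, hp⟩) hGres
    simpa [hG₀] using this
  refine ⟨fun p => f (G p), hf.comp G.continuous, fun p => ⟨G p, hGmem p, rfl⟩, fun p hp => ?_⟩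
  show f (G p) = p
  rw [hGg p hp, hfg p hp]

/-! ### The push lemma -/

section Push

variable {Γ : ℝ → ℂ}

/-- Boundary times of a label set are circle times: if `Z, Z' ⊆ [0, 1]` are disjoint, `Z'` is
closed, every disc time of `Γ` lies in `Z ∪ Z'`, every time of `Z` is a disc time, and `Γ` starts
(and ends) off the closed disc, then at a time of `Z` adherent to the complement of `Z` the loop is
on the unit circle. [folklore] -/
theorem norm_eq_one_of_mem_closure_compl (hΓc : Continuous Γ) (h01 : Γ 0 = Γ 1)
    (h0 : Γ 0 ∉ closedBall (0 : ℂ) 1) {Z Z' : Set ℝ} (hZ'c : IsClosed Z') (hZI : Z ⊆ Icc 0 1)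
    (hd : Disjoint Z Z')
    (hcov : ∀ t ∈ Icc (0 : ℝ) 1, Γ t ∈ closedBall (0 : ℂ) 1 → t ∈ Z ∪ Z')
    (hZK : ∀ t ∈ Z, Γ t ∈ closedBall (0 : ℂ) 1) {t : ℝ} (htZ : t ∈ Z) (htcl : t ∈ closure Zᶜ) :
    ‖Γ t‖ = 1 := by
  have htK := hZK t htZ
  have ht0 : t ≠ 0 := by rintro rfl; exact h0 htK
  have ht1 : t ≠ 1 := by rintro rfl; exact h0 (h01 ▸ htK)
  have htI := hZI htZ
  have htoo : t ∈ Ioo (0 : ℝ) 1 := ⟨lt_of_le_of_ne htI.1 (Ne.symm ht0), lt_of_le_of_ne htI.2 ht1⟩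
  have htZ' : t ∉ Z' := fun h => Set.disjoint_left.1 hd htZ h
  have hU : IsOpen (Z'ᶜ ∩ Ioo (0 : ℝ) 1) := hZ'c.isOpen_compl.inter isOpen_Ioo
  have h1 : t ∈ closure ((Z'ᶜ ∩ Ioo 0 1) ∩ Zᶜ) := hU.inter_closure ⟨⟨htZ', htoo⟩, htcl⟩
  have h2 : (Z'ᶜ ∩ Ioo (0 : ℝ) 1) ∩ Zᶜ ⊆ Γ ⁻¹' (closedBall 0 1)ᶜ := by
    rintro x ⟨⟨hxZ', hx⟩, hxZ⟩ hxK
    rcases hcov x (Ioo_subset_Icc_self hx) hxK with h | h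
    · exact hxZ h
    · exact hxZ' h
  have h3 : Γ t ∈ closure (closedBall (0 : ℂ) 1)ᶜ :=
    hΓc.closure_preimage_subset _ (closure_mono h2 h1)
  rw [closure_compl, interior_closedBall _ one_ne_zero] at h3
  have hle : ‖Γ t‖ ≤ 1 := mem_closedBall_zero_iff.1 htK
  have hge : 1 ≤ ‖Γ t‖ := not_lt.1 fun h => h3 (mem_ball_zero_iff.2 h)
  exact le_antisymm hle hge

/-- **The push lemma** (see the module docstring): a loop whose disc times split into two closed
label sets, each retractable onto a compact subset of the circle, has equal winding numbers about
any two circle points off the retracts and off the loop. [folklore] -/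
theorem wind_sub_eq_of_push (hΓc : Continuous Γ) (h01 : Γ 0 = Γ 1)
    (h0 : Γ 0 ∉ closedBall (0 : ℂ) 1)
    {R₁ R₂ : Set ℂ} (hR₁ : IsCompact R₁) (hR₂ : IsCompact R₂)
    (hR₁S : R₁ ⊆ sphere (0 : ℂ) 1) (hR₂S : R₂ ⊆ sphere (0 : ℂ) 1)
    {π₁ π₂ : ℂ → ℂ} (hπ₁c : Continuous π₁) (hπ₂c : Continuous π₂)
    (hπ₁R : ∀ p, π₁ p ∈ R₁) (hπ₂R : ∀ p, π₂ p ∈ R₂)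
    (hπ₁id : ∀ p ∈ R₁, π₁ p = p) (hπ₂id : ∀ p ∈ R₂, π₂ p = p)
    {Z₁ Z₂ : Set ℝ} (hZ₁c : IsClosed Z₁) (hZ₂c : IsClosed Z₂)
    (hZ₁I : Z₁ ⊆ Icc 0 1) (hZ₂I : Z₂ ⊆ Icc 0 1) (hdisj : Disjoint Z₁ Z₂)
    (hcover : ∀ t ∈ Icc (0 : ℝ) 1, Γ t ∈ closedBall (0 : ℂ) 1 → t ∈ Z₁ ∪ Z₂)
    (hZ₁K : ∀ t ∈ Z₁, Γ t ∈ closedBall (0 : ℂ) 1) (hZ₂K : ∀ t ∈ Z₂, Γ t ∈ closedBall (0 : ℂ) 1)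
    (hZ₁S : ∀ t ∈ Z₁, ‖Γ t‖ = 1 → Γ t ∈ R₁) (hZ₂S : ∀ t ∈ Z₂, ‖Γ t‖ = 1 → Γ t ∈ R₂)
    {c a : ℂ} (hc : ‖c‖ = 1) (ha : ‖a‖ = 1) (hc₁ : c ∉ R₁) (hc₂ : c ∉ R₂) (ha₁ : a ∉ R₁)
    (ha₂ : a ∉ R₂) (hcΓ : c ∉ range Γ) (haΓ : a ∉ range Γ) :
    wind (fun t => Γ t - c) = wind (fun t => Γ t - a) := by
  classical
  have hfr_cl : ∀ {Z : Set ℝ} {t : ℝ}, t ∈ frontier Z → t ∈ closure Zᶜ := fun {Z t} ht => by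
    rw [frontier_eq_closure_inter_closure] at ht
    exact ht.2
  -- the pushed loop
  set g : ℝ → ℂ := fun t => if t ∈ Z₂ then π₂ (Γ t) else Γ t with hg
  set Γ' : ℝ → ℂ := fun t => if t ∈ Z₁ then π₁ (Γ t) else g t with hΓ'
  have hfr₂ : ∀ t ∈ frontier {x | x ∈ Z₂}, π₂ (Γ t) = Γ t := fun t ht =>
    hπ₂id _ (hZ₂S t (hZ₂c.frontier_subset ht) (norm_eq_one_of_mem_closure_compl hΓc h01 h0 hZ₁c
      hZ₂I hdisj.symm (fun t ht htK => union_comm Z₁ Z₂ ▸ hcover t ht htK) hZ₂K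
      (hZ₂c.frontier_subset ht) (hfr_cl ht)))
  have hgc : Continuous g := Continuous.if hfr₂ (hπ₂c.comp hΓc) hΓc
  have hfr₁ : ∀ t ∈ frontier {x | x ∈ Z₁}, π₁ (Γ t) = g t := by
    intro t ht
    have htZ₁ : t ∈ Z₁ := hZ₁c.frontier_subset ht
    have htZ₂ : t ∉ Z₂ := fun h => Set.disjoint_left.1 hdisj htZ₁ h
    have hgt : g t = Γ t := by simp only [hg, if_neg htZ₂]
    rw [hgt]
    exact hπ₁id _ (hZ₁S t htZ₁ (norm_eq_one_of_mem_closure_compl hΓc h01 h0 hZ₂c hZ₁I hdisj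
      hcover hZ₁K htZ₁ (hfr_cl ht)))
  have hΓ'c : Continuous Γ' := Continuous.if hfr₁ (hπ₁c.comp hΓc) hgc
  have hΓ'₁ : ∀ t ∈ Z₁, Γ' t = π₁ (Γ t) := fun t ht => by simp only [hΓ', if_pos ht]
  have hΓ'₂ : ∀ t ∈ Z₂, Γ' t = π₂ (Γ t) := fun t ht => by
    have : t ∉ Z₁ := fun h => Set.disjoint_left.1 hdisj h ht
    simp only [hΓ', hg, if_neg this, if_pos ht]
  have hΓ'₀ : ∀ t, t ∉ Z₁ → t ∉ Z₂ → Γ' t = Γ t := fun t h1 h2 => by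
    simp only [hΓ', hg, if_neg h1, if_neg h2]
  have h0Z : ∀ {t}, Γ t ∉ closedBall (0 : ℂ) 1 → t ∉ Z₁ ∧ t ∉ Z₂ := fun h =>
    ⟨fun h' => h (hZ₁K _ h'), fun h' => h (hZ₂K _ h')⟩
  have hΓ'01 : Γ' 0 = Γ' 1 := by
    obtain ⟨h0₁, h0₂⟩ := h0Z h0
    obtain ⟨h1₁, h1₂⟩ := h0Z (h01 ▸ h0)
    rw [hΓ'₀ 0 h0₁ h0₂, hΓ'₀ 1 h1₁ h1₂, h01]
  -- a radius separating `c`, `a` from the retracts and the loop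
  set M : Set ℂ := R₁ ∪ R₂ ∪ Γ '' Icc 0 1 with hM
  have hMc : IsCompact M := (hR₁.union hR₂).union (isCompact_Icc.image hΓc)
  have hcM : c ∉ M := by
    rintro ((h | h) | ⟨t, -, ht⟩)
    · exact hc₁ h
    · exact hc₂ h
    · exact hcΓ ⟨t, ht⟩
  have haM : a ∉ M := by
    rintro ((h | h) | ⟨t, -, ht⟩)
    · exact ha₁ h
    · exact ha₂ h
    · exact haΓ ⟨t, ht⟩
  obtain ⟨d, hd, hd1, hdc, hda⟩ : ∃ d > 0, d ≤ 1 ∧ ball c d ⊆ Mᶜ ∧ ball a d ⊆ Mᶜ := by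
    obtain ⟨dc, hdc, hdcM⟩ := Metric.isOpen_iff.1 hMc.isClosed.isOpen_compl c hcM
    obtain ⟨da, hda, hdaM⟩ := Metric.isOpen_iff.1 hMc.isClosed.isOpen_compl a haM
    refine ⟨min 1 (min dc da), by positivity, min_le_left _ _, ?_, ?_⟩
    · exact (ball_subset_ball ((min_le_right _ _).trans (min_le_left _ _))).trans hdcM
    · exact (ball_subset_ball ((min_le_right _ _).trans (min_le_right _ _))).trans hdaM
  -- the pushed loop misses `N = 𝔻 ∪ B(c, d) ∪ B(a, d)`
  set N : Set ℂ := ball 0 1 ∪ ball c d ∪ ball a d with hN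
  have hRN : ∀ {R : Set ℂ} {q : ℂ}, R ⊆ sphere (0 : ℂ) 1 → R ⊆ M → q ∈ R → q ∉ N := by
    intro R q hRS hRM hq hmem
    have hqS : ‖q‖ = 1 := mem_sphere_zero_iff_norm.1 (hRS hq)
    rcases hmem with (h | h) | h
    · rw [mem_ball_zero_iff, hqS] at h
      exact lt_irrefl _ h
    · exact hdc h (hRM hq)
    · exact hda h (hRM hq)
  have hΓ'N : ∀ t ∈ Icc (0 : ℝ) 1, Γ' t ∉ N := by
    intro t ht
    by_cases h1 : t ∈ Z₁
    · rw [hΓ'₁ t h1]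
      exact hRN hR₁S (fun q hq => Or.inl (Or.inl hq)) (hπ₁R _)
    by_cases h2 : t ∈ Z₂
    · rw [hΓ'₂ t h2]
      exact hRN hR₂S (fun q hq => Or.inl (Or.inr hq)) (hπ₂R _)
    intro hmem
    have hK : Γ t ∉ closedBall (0 : ℂ) 1 := fun hK => by
      rcases hcover t ht hK with h | h
      · exact h1 h
      · exact h2 h
    have hvM : Γ t ∈ M := Or.inr ⟨t, ht, rfl⟩
    rw [hΓ'₀ t h1 h2] at hmem
    rcases hmem with (h | h) | h
    · exact hK (ball_subset_closedBall h)
    · exact hdc h hvM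
    · exact hda h hvM
  -- `N` is connected and contains `c` and `a`
  have hnear : ∀ {q : ℂ}, ‖q‖ = 1 → ((1 - d / 2 : ℝ) : ℂ) * q ∈ ball (0 : ℂ) 1 ∩ ball q d := by
    intro q hq
    have hd2 : 0 ≤ 1 - d / 2 := by linarith
    constructor
    · rw [mem_ball_zero_iff, norm_mul, Complex.norm_real, Real.norm_eq_abs, abs_of_nonneg hd2, hq]
      linarith
    · rw [mem_ball, dist_eq_norm, show ((1 - d / 2 : ℝ) : ℂ) * q - q = -(((d / 2 : ℝ) : ℂ) * q) by
        push_cast; ring, norm_neg, norm_mul, Complex.norm_real, Real.norm_eq_abs,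
        abs_of_nonneg (by linarith), hq]
      linarith
  have hNconn : IsPreconnected N := by
    have h1 : IsPreconnected (ball (0 : ℂ) 1 ∪ ball c d) :=
      IsPreconnected.union _ (hnear hc).1 (hnear hc).2 (convex_ball _ _).isPreconnected
        (convex_ball _ _).isPreconnected
    exact IsPreconnected.union _ (Or.inl (hnear ha).1) (hnear ha).2 h1
      (convex_ball _ _).isPreconnected
  have hcN : c ∈ N := Or.inl (Or.inr (mem_ball_self hd))
  have haN : a ∈ N := Or.inr (mem_ball_self hd)
  -- the straight-line homotopy avoids `c` and `a`
  have hcomb : ∀ s ∈ Icc (0 : ℝ) 1, ∀ t ∈ Icc (0 : ℝ) 1, ∀ p : ℂ, ‖p‖ = 1 → p ∉ R₁ → p ∉ R₂ →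
      p ∉ range Γ → ((1 - s : ℝ) : ℂ) * Γ t + (s : ℂ) * Γ' t ≠ p := by
    intro s hs t ht p hp hp₁ hp₂ hpΓ heq
    have hfix : Γ' t = Γ t → False := fun he => by
      rw [he, ← add_mul] at heq
      push_cast at heq
      rw [sub_add_cancel, one_mul] at heq
      exact hpΓ ⟨t, heq⟩
    have hinner : ∀ {R : Set ℂ} {π : ℂ → ℂ}, R ⊆ sphere (0 : ℂ) 1 → (∀ q, π q ∈ R) →
        (∀ q ∈ R, π q = q) → p ∉ R → Γ t ∈ closedBall (0 : ℂ) 1 → (‖Γ t‖ = 1 → Γ t ∈ R) →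
        Γ' t = π (Γ t) → False := by
      intro R π hRS hπR hπid hpR hK hS hval
      by_cases hnorm : ‖Γ t‖ = 1
      · exact hfix (by rw [hval, hπid _ (hS hnorm)])
      · have hint : Γ t ∈ interior (closedBall (0 : ℂ) 1) := by
          rw [interior_closedBall _ one_ne_zero, mem_ball_zero_iff]
          exact lt_of_le_of_ne (mem_closedBall_zero_iff.1 hK) hnorm
        have hcl : π (Γ t) ∈ closure (closedBall (0 : ℂ) 1) :=
          subset_closure (sphere_subset_closedBall (hRS (hπR _)))
        rcases eq_or_lt_of_le hs.2 with hs1 | hs1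
        · rw [hs1, hval] at heq
          push_cast at heq
          rw [sub_self, zero_mul, zero_add, one_mul] at heq
          exact hpR (heq ▸ hπR _)
        · have hmem := (convex_closedBall (0 : ℂ) 1).combo_interior_closure_mem_interior hint hcl
            (a := 1 - s) (b := s) (sub_pos.2 hs1) hs.1 (by ring)
          rw [interior_closedBall _ one_ne_zero, mem_ball_zero_iff] at hmem
          have : ((1 - s : ℝ) • Γ t + s • π (Γ t) : ℂ) = p := by
            rw [← heq, hval, Complex.real_smul, Complex.real_smul]
          rw [this, hp] at hmem
          exact lt_irrefl _ hmem
    by_cases h1 : t ∈ Z₁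
    · exact hinner hR₁S hπ₁R hπ₁id hp₁ (hZ₁K t h1) (hZ₁S t h1) (hΓ'₁ t h1)
    by_cases h2 : t ∈ Z₂
    · exact hinner hR₂S hπ₂R hπ₂id hp₂ (hZ₂K t h2) (hZ₂S t h2) (hΓ'₂ t h2)
    exact hfix (hΓ'₀ t h1 h2)
  have hwind : ∀ p : ℂ, ‖p‖ = 1 → p ∉ R₁ → p ∉ R₂ → p ∉ range Γ →
      wind (fun t => Γ t - p) = wind (fun t => Γ' t - p) := by
    intro p hp hp₁ hp₂ hpΓ
    have key := wind_eq_of_homotopy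
      (H := fun s t => ((1 - s : ℝ) : ℂ) * Γ t + (s : ℂ) * Γ' t - p) ?_ ?_ ?_
    · have e0 : (fun t => ((1 - 0 : ℝ) : ℂ) * Γ t + ((0 : ℝ) : ℂ) * Γ' t - p) = fun t => Γ t - p := by
        funext t; push_cast; ring
      have e1 : (fun t => ((1 - 1 : ℝ) : ℂ) * Γ t + ((1 : ℝ) : ℂ) * Γ' t - p) = fun t => Γ' t - p := by
        funext t; push_cast; ring
      rw [e0, e1] at key
      exact key
    · exact Continuous.continuousOn (by fun_prop)
    · intro s _
      show ((1 - s : ℝ) : ℂ) * Γ 0 + (s : ℂ) * Γ' 0 - p = ((1 - s : ℝ) : ℂ) * Γ 1 + (s : ℂ) * Γ' 1 - p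
      rw [h01, hΓ'01]
    · intro s hs t ht
      exact sub_ne_zero.2 (hcomb s hs t ht p hp hp₁ hp₂ hpΓ)
  -- conclude on the pushed loop
  rw [hwind c hc hc₁ hc₂ hcΓ, hwind a ha ha₁ ha₂ haΓ]
  refine wind_sub_eq_of_mem_connectedComponentIn hΓ'c.continuousOn hΓ'01
    (isCompact_Icc.image hΓ'c).isClosed (mapsTo_image Γ' (Icc 0 1)) ?_
  refine hNconn.subset_connectedComponentIn hcN ?_ haN
  intro x hx hxK
  obtain ⟨t, ht, rfl⟩ := hxK
  exact hΓ'N t ht hx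

end Push

end Literature.Topology.PlaneTopology
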